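/-
Copyright (c) 2026 the pub-hodgecm-mathlib formalisation cell (harness21).  Prover seat hodgecm-mathlib-R90-C131-p05 (g3), R90-TF SLAB section S4
«Ch13.1–2» (base R90-C131), h413 = `stmt-HodgeConjecture-24833`; brick (W̃ε-VAL)(2) = CARD C, FILE B (S4 dealer K2E2-plan (g8), R90 bus 2026-09-05T02:23:33Z;
census 02:27Z).
-/
import Summits.HodgeConjecture.HodgeConjecture.Theorems.R90S4TypeTwoTorusNormaliser       -- (this seat) FILE A: `index_centralizer_subgroupOf_normalizer_eq_two_of_frame` (`[N(Z(γ)) : Z(γ)] = 2` over a field, type-(2) block frame)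
import Summits.HodgeConjecture.HodgeConjecture.Theorems.R90S4EpsWeylFinite               -- ★ p864025 (this base, g2) WEYL-ε: the ε-normaliser predicate, `le_normalizer_of_mem_iff_epsNormalizer`; brings `epsLoc`, `GtLoc`, ★ `epsLoc_apply_coe`
import HarnessLib

/-!
# R90-TF · S4 — (W̃ε-VAL)(2) `R90S4TypeTwoEpsWeylIndex`: for a type-(2) Cartan subgroup the ε-twisted Weyl group `W̃^ε_T = Ñ^ε_T ∕ T̃` has order `2` — the ε-normaliser of
# `T̃ = Cent_{G̃_v}(γ₀)` IS the full normaliser, and `[N_{G̃_v}(T̃) : T̃] = |Gal(L_w[A] ∕ L_w)| = 2` (Rogawski 1990, §3.7 Prop. 3.7.1 p. 29: `Ω_F(T, G) = ℤ∕2` for `T = T_K × E¹`; §12.5 p. 182)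

Cell `hodgecm-mathlib`, crux H413 = `stmt-HodgeConjecture-24833`, route of record `HCCMUnconditional`; R90-TF section S4 (Rogawski Ch. 13.1–2, base `R90-C131`), seat
R90-C131-p05 (g3); CARD C = F2 = row (W̃ε-VAL) for TYPE (2) of the (WEYL-COUNT-T) letter of the (B1) T-WIF assembly: the `hwF = 2` row of ★ p864386
`isStableTransportDict_and_isTwistedWeylCountT_of_forall_member` at type-(2) members (both GO-DICT2 branches: `N(T,T)·[N(T):T] = 2·1 = 1·2`).  The type-(2) TWIN of ★
p864420 `R90S4TypeOneEpsWeylIndex` (this base, g2): the eigenframe letter `(u) (hu) (hu1) (P) (hP)` is REPLACED by the block-frame letter `(P) (e) (A) (u) (hP) (hA)` of ★ F1″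
p864495 `R90S4TypeTwoStableClassSplit` :65–:67 (the assembler feeds it from CARD D §2 + FILE 0 `exists_blockFrame_gqs_of_charpoly`, passing from the `Gqs` member exactly as
the type-(1) row does: `Gqs L v = (cmDatum L 3 (splitFormGL L)).Local v`); `(N') (hN')` VERBATIM ★ p864420 :231–:234.  THEOREMS ONLY (no `def`, no `instance`, no notation, no
named-fact hypothesis, no `sorry`; default heartbeats); ★-only imports; lane `--supports stmt-HodgeConjecture-24833 --as helper`.

THE MATHEMATICS.  `v` non-split, `G̃_v = GL₃(L ⊗ L⁺_v)` (★ `GtLoc`; `L ⊗ L⁺_v = L_w` a FIELD, ★ `LocalRing.isField_of_smul_eq`), `ε = epsLoc L Φ v` (`ε(g) = Φ_v⁻¹ ᵗ(σg)⁻¹ Φ_v`,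
`Φ : GL₃(L)` ARBITRARY — no hermitian hypothesis is used), `γ₀ ∈ G_v = U(Φ)(L⁺_v)` of TYPE (2): a block frame `γ₀ P = P · e·(A ⊕ (u))` with `χ_A` an IRREDUCIBLE quadratic over
`L_w`; `T̃ := Cent_{G̃_v}(γ₀) ≅ L_w[A]^× × L_w^×` (Rogawski's `T_K × E¹` read in `G̃_v`), `Ñ^ε_T := {m ∈ N_{G̃_v}(T̃) : m ε(m)⁻¹ ∈ T̃}` (★ WEYL-ε's predicate, `N'` any
subgroup carrying it).
* §1 `ε` IS A BIJECTION of `G̃_v` (`epsLoc_bijective`: `σ_v` and `g ↦ ᵗg⁻¹` are involutions — no hermitian hypothesis), fixing `G_v` pointwise (★ `epsLoc_apply_coe`); hence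
  `ε(m) ∈ T̃ ⟺ m ∈ T̃` and `ε(N(T̃)) ⊆ N(T̃)` (`epsLoc_mem_centralizer_iff`, `epsLoc_mem_normalizer_centralizer`).
* §2 **`[N_{G̃_v}(T̃) : T̃] = 2`** (`index_centralizer_subgroupOf_normalizer_eq_two_gtLoc`): FILE A `index_centralizer_subgroupOf_normalizer_eq_two_of_frame` over the field
  `L_w` (`2 ≠ 0`: characteristic zero) — `N(T̃)∕T̃ ≅ Gal(L_w[A]∕L_w)`, the swap realised `L_w`-rationally inside the `2`-block, nothing moving the `1`-block.
* §3 THE ε-STEP, in its index-2 shadow (the dealer's `W`-route «`Ad(m ε(m)⁻¹)|_{T̃} = w·(ε w ε⁻¹)⁻¹ = 1` since `Aut(ℤ∕2) = 1`» IS the coset identity `a b ∈ H ⟺ (a ∈ H ⟺ b ∈ H)`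
  for an index-2 `H`, Mathlib `Subgroup.mul_mem_iff_of_index_two` — no quotient group, no self-centralising lemma): for `m ∈ N(T̃)`,
  `m ε(m)⁻¹ ∈ T̃ ⟺ (m ∈ T̃ ⟺ ε(m)⁻¹ ∈ T̃) ⟺ (m ∈ T̃ ⟺ m ∈ T̃)` (`mul_epsLoc_inv_mem_centralizer_of_mem_normalizer_typeTwo`).  So `N(T̃) ≤ Ñ^ε_T`; with ★ WEYL-ε's
  `Ñ^ε_T ≤ N(T̃)`: **`Ñ^ε_T = N_{G̃_v}(T̃)`** (`epsNormalizer_eq_normalizer_of_typeTwo`) and **`[Ñ^ε_T : T̃] = 2`**, `Nat.card (Ñ^ε_T ⧸ T̃) = 2`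
  (`index_centralizer_subgroupOf_epsNormalizer_eq_two_of_typeTwo`, `natCard_epsNormalizer_quotient_centralizer_eq_two_of_typeTwo`) — print's `Ω_F(T, G) = ℤ∕2` for
  `T = T_K × E¹` [Prop. 3.7.1], for BOTH type-(2) classes of ★ F1″ (whereas `[N_U(T) : T] ∈ {2, 1}`).

HONEST LABEL: HC_CM is proved only modulo the 7 printed citations (2 remaining named inputs: hLiu418 = `stmt-HodgeConjecture-24832`, h413 = `stmt-HodgeConjecture-24833`) until
rung 0 closes; (W̃ε-VAL)(2) is one per-type input of (WEYL-COUNT-T) of the (B1) assembly behind the OPEN (W-NP) socket — a ★ helper closes no socket; REL ≠ ★ ≠ BUILT; count-neutral.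

## References
* [Rogawski1990] J. D. Rogawski, *Automorphic Representations of Unitary Groups in Three Variables*, Ann. of Math. Stud. 123 (1990), §3.7 Prop. 3.7.1 p. 29 (`Ω_F(T, G)`),
  §3.6 pp. 28, 31 (type (2): `T_K × E¹`), §12.5 pp. 182, 186 (the twisted Weyl integration formula), §3.10–3.11 pp. 33–35 (`ε`, norms).
* [SpringerLAG1998] T. A. Springer, *Linear Algebraic Groups*, 2nd ed. (1998), 7.1.5.
-/

set_option autoImplicit false
-- the mandated namespace repeats the single-problem summit's segment (`HodgeConjecture.HodgeConjecture`)
set_option linter.dupNamespace false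

open Matrix Polynomial
open NumberField IsDedekindDomain
open Literature.NumberTheory.Automorphic Literature.NumberTheory.Automorphic.UnitaryGroup Literature.NumberTheory.Rogawski1990
open Literature.NumberTheory.GaloisRepresentations (glTransposeInv coe_glTransposeInv_apply)
open Summit.HodgeConjecture.HodgeConjecture.Cruxes.H413.K2E1GlobalTestFunctionsTwisted (formLocal twistLocal twistLocal_apply)
open scoped MatrixGroups

namespace Summit.HodgeConjecture.HodgeConjecture.R90.S4

section TypeTwo

variable (L : Type) [Field L] [NumberField L] [IsCMField L] (Φ : GL (Fin 3) L) (v : HeightOneSpectrum (𝓞 ↥(maximalRealSubfield L)))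

/-! ## §1 `ε_v` is a bijection of `G̃_v` fixing `G_v`: `ε(T̃) = T̃`, `ε(N(T̃)) ⊆ N(T̃)` -/

/-- **`ε_v : G̃_v → G̃_v` is a bijection** (any `Φ`, any `v`): `ε(g) = Φ_v⁻¹ · ᵗ(σg)⁻¹ · Φ_v` is conjugation by `Φ_v⁻¹` after the involutions `g ↦ ᵗg⁻¹` and `σ_v` (★ `conjLocal_conjLocal_cm`).
[cite: Rogawski1990, §3.10 p. 33; §3.11 p. 34] -/
theorem epsLoc_bijective : Function.Bijective (epsLoc L Φ v) := by
  have hσσ : (conjLocal L (IsCMField.complexConj L) v).comp (conjLocal L (IsCMField.complexConj L) v) = RingHom.id (LocalRing L v) :=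
    RingHom.ext (conjLocal_conjLocal_cm L v)
  have hSS : ∀ h : GtLoc L v, Matrix.GeneralLinearGroup.map (conjLocal L (IsCMField.complexConj L) v)
      (Matrix.GeneralLinearGroup.map (conjLocal L (IsCMField.complexConj L) v) h) = h := fun h => by
    rw [← Matrix.GeneralLinearGroup.map_comp_apply, ← Matrix.GeneralLinearGroup.map_comp, hσσ, Matrix.GeneralLinearGroup.map_id]
    rfl
  have hTT : ∀ h : GtLoc L v, glTransposeInv (Fin 3) (LocalRing L v) (glTransposeInv (Fin 3) (LocalRing L v) h) = h := fun h =>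
    Units.ext (by rw [coe_glTransposeInv_apply, ← map_inv, coe_glTransposeInv_apply, inv_inv, Matrix.transpose_transpose])
  constructor
  · intro a b hab
    rw [epsLoc_apply, epsLoc_apply, twistLocal_apply, twistLocal_apply] at hab
    have h1 : glTransposeInv (Fin 3) (LocalRing L v) (Matrix.GeneralLinearGroup.map (conjLocal L (IsCMField.complexConj L) v) a) =
        glTransposeInv (Fin 3) (LocalRing L v) (Matrix.GeneralLinearGroup.map (conjLocal L (IsCMField.complexConj L) v) b) :=
      mul_left_cancel (mul_right_cancel hab)
    have h2 := congrArg (fun x => Matrix.GeneralLinearGroup.map (conjLocal L (IsCMField.complexConj L) v) (glTransposeInv (Fin 3) (LocalRing L v) x)) h1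
    simpa only [hTT, hSS] using h2
  · intro h
    refine ⟨Matrix.GeneralLinearGroup.map (conjLocal L (IsCMField.complexConj L) v)
      (glTransposeInv (Fin 3) (LocalRing L v) (formLocal L 3 Φ v * h * (formLocal L 3 Φ v)⁻¹)), ?_⟩
    rw [epsLoc_apply, twistLocal_apply, hSS, hTT]
    group

/-- **`ε(m) ∈ T̃ ⟺ m ∈ T̃`** for `T̃ = Cent_{G̃_v}(γ)`, `γ ∈ G_v`: `ε` is an injective homomorphism with `ε(γ) = γ` (★ `epsLoc_apply_coe`). [cite: Rogawski1990, §12.5 p. 186; §3.10 p. 33] -/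
theorem epsLoc_mem_centralizer_iff (γ : (UnitaryGroup.cmDatum L 3 (Φ : Matrix (Fin 3) (Fin 3) L)).Local v) (m : GtLoc L v) :
    epsLoc L Φ v m ∈ Subgroup.centralizer ({(γ.val : GtLoc L v)} : Set (GtLoc L v)) ↔ m ∈ Subgroup.centralizer ({(γ.val : GtLoc L v)} : Set (GtLoc L v)) := by
  rw [Subgroup.mem_centralizer_singleton_iff, Subgroup.mem_centralizer_singleton_iff]
  constructor
  · intro h
    apply (epsLoc_bijective L Φ v).1
    rw [map_mul, map_mul, epsLoc_apply_coe]
    exact h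
  · intro h
    have h' := congrArg (epsLoc L Φ v) h
    rwa [map_mul, map_mul, epsLoc_apply_coe] at h'

/-- **`ε(N(T̃)) ⊆ N(T̃)`**: `ε` is a bijection with `ε(T̃) = T̃`. [cite: Rogawski1990, §12.5 p. 186] [cite: SpringerLAG1998, 7.1.5] -/
theorem epsLoc_mem_normalizer_centralizer (γ : (UnitaryGroup.cmDatum L 3 (Φ : Matrix (Fin 3) (Fin 3) L)).Local v) {m : GtLoc L v}
    (hm : m ∈ Subgroup.normalizer ((Subgroup.centralizer ({(γ.val : GtLoc L v)} : Set (GtLoc L v)) : Subgroup (GtLoc L v)) : Set (GtLoc L v))) :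
    epsLoc L Φ v m ∈ Subgroup.normalizer ((Subgroup.centralizer ({(γ.val : GtLoc L v)} : Set (GtLoc L v)) : Subgroup (GtLoc L v)) : Set (GtLoc L v)) := by
  rw [Subgroup.mem_normalizer_iff] at hm ⊢
  intro t
  obtain ⟨t', rfl⟩ := (epsLoc_bijective L Φ v).2 t
  rw [epsLoc_mem_centralizer_iff, hm t', ← epsLoc_mem_centralizer_iff L Φ v γ (m * t' * m⁻¹), map_mul, map_mul, map_inv]

/-! ## §2 `[N_{G̃_v}(T̃) : T̃] = 2` for a type-(2) `γ₀` -/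

/-- **`[N_{G̃_v}(T̃) : T̃] = 2` for `T̃ = Cent_{G̃_v}(γ₀)`, `γ₀` of type (2)** (`v` non-split; block frame `γ₀ P = P · e·(A ⊕ (u))`, `χ_A` irreducible over `L_w`): FILE A
`index_centralizer_subgroupOf_normalizer_eq_two_of_frame` over the field `L ⊗ L⁺_v = L_w` (★ `LocalRing.isField_of_smul_eq`; `2 ≠ 0` in characteristic zero) —
`N(T̃)∕T̃ ≅ Gal(L_w[A]∕L_w) = ℤ∕2`. [cite: Rogawski1990, §3.7 Prop. 3.7.1 p. 29; §3.6 p. 31] -/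
theorem index_centralizer_subgroupOf_normalizer_eq_two_gtLoc (hns : ∀ w : PlacesOver L v, IsCMField.complexConj L • w.1 = w.1)
    (γ₀ : (UnitaryGroup.cmDatum L 3 (Φ : Matrix (Fin 3) (Fin 3) L)).Local v) (P : GL (Fin 3) (LocalRing L v)) (e : Fin 2 ⊕ Fin 1 ≃ Fin 3)
    (A : Matrix (Fin 2) (Fin 2) (LocalRing L v)) (u : LocalRing L v)
    (hP : (γ₀.val : GL (Fin 3) (LocalRing L v)).val * P.val = P.val * reindex e e (fromBlocks A 0 0 !![u])) (hA : Irreducible A.charpoly) :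
    ((Subgroup.centralizer ({(γ₀.val : GtLoc L v)} : Set (GtLoc L v))).subgroupOf
      (Subgroup.normalizer ((Subgroup.centralizer ({(γ₀.val : GtLoc L v)} : Set (GtLoc L v)) : Subgroup (GtLoc L v)) : Set (GtLoc L v)))).index = 2 := by
  haveI : Algebra.IsQuadraticExtension ↥(maximalRealSubfield L) L := IsCMField.isQuadraticExtension L
  obtain ⟨w⟩ := (inferInstance : Nonempty (PlacesOver L v))
  letI : Field (LocalRing L v) := (LocalRing.isField_of_smul_eq (IsCMField.complexConj L) (IsCMField.complexConj_ne_one L) w (hns w)).toField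
  have h2 : (2 : LocalRing L v) ≠ 0 := by
    rw [← map_ofNat (algebraMap L (LocalRing L v)) 2]
    exact (map_ne_zero_iff _ (algebraMap L (LocalRing L v)).injective).2 two_ne_zero
  exact index_centralizer_subgroupOf_normalizer_eq_two_of_frame e h2 hP hA

/-! ## §3 The ε-step: the ε-normaliser of a type-(2) `T̃` is the full normaliser, of index `2` -/

/-- **THE ε-STEP: `m · ε(m)⁻¹ ∈ T̃` for every `m ∈ N_{G̃_v}(T̃)`**, `T̃ = Cent_{G̃_v}(γ₀)`, `γ₀` of type (2) (`v` non-split).  `T̃` has index `2` in `N(T̃)` (§2), so for `a, b ∈ N(T̃)`: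
`a b ∈ T̃ ⟺ (a ∈ T̃ ⟺ b ∈ T̃)` (Mathlib `Subgroup.mul_mem_iff_of_index_two` — the `W = ℤ∕2` argument «`[m]·[ε m]⁻¹ = 1` because `ε` acts trivially on `ℤ∕2`»); with `a = m`,
`b = ε(m)⁻¹ ∈ N(T̃)` (§1) and `ε(m) ∈ T̃ ⟺ m ∈ T̃` (§1) the right-hand side holds. [cite: Rogawski1990, §3.7 Prop. 3.7.1 p. 29; §12.5 p. 186] -/
theorem mul_epsLoc_inv_mem_centralizer_of_mem_normalizer_typeTwo (hns : ∀ w : PlacesOver L v, IsCMField.complexConj L • w.1 = w.1)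
    (γ₀ : (UnitaryGroup.cmDatum L 3 (Φ : Matrix (Fin 3) (Fin 3) L)).Local v) (P : GL (Fin 3) (LocalRing L v)) (e : Fin 2 ⊕ Fin 1 ≃ Fin 3)
    (A : Matrix (Fin 2) (Fin 2) (LocalRing L v)) (u : LocalRing L v)
    (hP : (γ₀.val : GL (Fin 3) (LocalRing L v)).val * P.val = P.val * reindex e e (fromBlocks A 0 0 !![u])) (hA : Irreducible A.charpoly)
    {m : GtLoc L v} (hm : m ∈ Subgroup.normalizer ((Subgroup.centralizer ({(γ₀.val : GtLoc L v)} : Set (GtLoc L v)) : Subgroup (GtLoc L v)) : Set (GtLoc L v))) :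
    m * (epsLoc L Φ v m)⁻¹ ∈ Subgroup.centralizer ({(γ₀.val : GtLoc L v)} : Set (GtLoc L v)) := by
  have hidx := index_centralizer_subgroupOf_normalizer_eq_two_gtLoc L Φ v hns γ₀ P e A u hP hA
  have hεN := epsLoc_mem_normalizer_centralizer L Φ v γ₀ hm
  have key := Subgroup.mul_mem_iff_of_index_two hidx (a := ⟨m, hm⟩) (b := ⟨epsLoc L Φ v m, hεN⟩⁻¹)
  simp only [Subgroup.mem_subgroupOf, Subgroup.coe_mul, Subgroup.coe_inv] at key
  rw [key, inv_mem_iff, epsLoc_mem_centralizer_iff]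

/-- **The ε-normaliser of a type-(2) `T̃ = Cent_{G̃_v}(γ₀)` is the FULL normaliser**: any subgroup `N'` with ★ WEYL-ε's membership predicate (`m ∈ N(T̃) ∧ m ε(m)⁻¹ ∈ T̃`)
equals `N_{G̃_v}(T̃)` (§3 ε-step + ★ `le_normalizer_of_mem_iff_epsNormalizer`). [cite: Rogawski1990, §3.7 Prop. 3.7.1 p. 29; §12.5 p. 186] -/
theorem epsNormalizer_eq_normalizer_of_typeTwo (hns : ∀ w : PlacesOver L v, IsCMField.complexConj L • w.1 = w.1)
    (γ₀ : (UnitaryGroup.cmDatum L 3 (Φ : Matrix (Fin 3) (Fin 3) L)).Local v) (P : GL (Fin 3) (LocalRing L v)) (e : Fin 2 ⊕ Fin 1 ≃ Fin 3)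
    (A : Matrix (Fin 2) (Fin 2) (LocalRing L v)) (u : LocalRing L v)
    (hP : (γ₀.val : GL (Fin 3) (LocalRing L v)).val * P.val = P.val * reindex e e (fromBlocks A 0 0 !![u])) (hA : Irreducible A.charpoly)
    (N' : Subgroup (GtLoc L v))
    (hN' : ∀ m, m ∈ N' ↔
      m ∈ Subgroup.normalizer ((Subgroup.centralizer ({(γ₀.val : GtLoc L v)} : Set (GtLoc L v)) : Subgroup (GtLoc L v)) : Set (GtLoc L v)) ∧
        m * (epsLoc L Φ v m)⁻¹ ∈ Subgroup.centralizer ({(γ₀.val : GtLoc L v)} : Set (GtLoc L v))) :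
    N' = Subgroup.normalizer ((Subgroup.centralizer ({(γ₀.val : GtLoc L v)} : Set (GtLoc L v)) : Subgroup (GtLoc L v)) : Set (GtLoc L v)) :=
  le_antisymm (le_normalizer_of_mem_iff_epsNormalizer L Φ v γ₀ N' hN')
    fun _ hm => (hN' _).2 ⟨hm, mul_epsLoc_inv_mem_centralizer_of_mem_normalizer_typeTwo L Φ v hns γ₀ P e A u hP hA hm⟩

/-- **(W̃ε-VAL)(2): `[Ñ^ε_T : T̃] = 2` for every type-(2) `γ₀`** (`v` non-split; block-frame letter `P e A u hP hA`; `N'` any subgroup of `G̃_v` with ★ WEYL-ε's iff-predicate at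
`T̃ = Cent_{G̃_v}(γ₀)`): the `hwF` value `wF = 2` of the (WEYL-COUNT-T) bridge at type (2) — for BOTH classes of ★ F1″ (print: `Ω_F(T, G) = ℤ∕2` for `T = T_K × E¹`).
[cite: Rogawski1990, §3.7 Prop. 3.7.1 p. 29; §12.5 pp. 182, 186] -/
theorem index_centralizer_subgroupOf_epsNormalizer_eq_two_of_typeTwo (hns : ∀ w : PlacesOver L v, IsCMField.complexConj L • w.1 = w.1)
    (γ₀ : (UnitaryGroup.cmDatum L 3 (Φ : Matrix (Fin 3) (Fin 3) L)).Local v) (P : GL (Fin 3) (LocalRing L v)) (e : Fin 2 ⊕ Fin 1 ≃ Fin 3)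
    (A : Matrix (Fin 2) (Fin 2) (LocalRing L v)) (u : LocalRing L v)
    (hP : (γ₀.val : GL (Fin 3) (LocalRing L v)).val * P.val = P.val * reindex e e (fromBlocks A 0 0 !![u])) (hA : Irreducible A.charpoly)
    (N' : Subgroup (GtLoc L v))
    (hN' : ∀ m, m ∈ N' ↔
      m ∈ Subgroup.normalizer ((Subgroup.centralizer ({(γ₀.val : GtLoc L v)} : Set (GtLoc L v)) : Subgroup (GtLoc L v)) : Set (GtLoc L v)) ∧
        m * (epsLoc L Φ v m)⁻¹ ∈ Subgroup.centralizer ({(γ₀.val : GtLoc L v)} : Set (GtLoc L v))) :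
    ((Subgroup.centralizer ({(γ₀.val : GtLoc L v)} : Set (GtLoc L v))).subgroupOf N').index = 2 := by
  rw [epsNormalizer_eq_normalizer_of_typeTwo L Φ v hns γ₀ P e A u hP hA N' hN']
  exact index_centralizer_subgroupOf_normalizer_eq_two_gtLoc L Φ v hns γ₀ P e A u hP hA

/-- **`W̃^ε_T` has exactly `2` elements** (type (2), `v` non-split): `Nat.card (Ñ^ε_T ⧸ T̃) = 2`. [cite: Rogawski1990, §3.7 Prop. 3.7.1 p. 29; §12.5 p. 182] -/
theorem natCard_epsNormalizer_quotient_centralizer_eq_two_of_typeTwo (hns : ∀ w : PlacesOver L v, IsCMField.complexConj L • w.1 = w.1)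
    (γ₀ : (UnitaryGroup.cmDatum L 3 (Φ : Matrix (Fin 3) (Fin 3) L)).Local v) (P : GL (Fin 3) (LocalRing L v)) (e : Fin 2 ⊕ Fin 1 ≃ Fin 3)
    (A : Matrix (Fin 2) (Fin 2) (LocalRing L v)) (u : LocalRing L v)
    (hP : (γ₀.val : GL (Fin 3) (LocalRing L v)).val * P.val = P.val * reindex e e (fromBlocks A 0 0 !![u])) (hA : Irreducible A.charpoly)
    (N' : Subgroup (GtLoc L v))
    (hN' : ∀ m, m ∈ N' ↔
      m ∈ Subgroup.normalizer ((Subgroup.centralizer ({(γ₀.val : GtLoc L v)} : Set (GtLoc L v)) : Subgroup (GtLoc L v)) : Set (GtLoc L v)) ∧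
        m * (epsLoc L Φ v m)⁻¹ ∈ Subgroup.centralizer ({(γ₀.val : GtLoc L v)} : Set (GtLoc L v))) :
    Nat.card (↥N' ⧸ (Subgroup.centralizer ({(γ₀.val : GtLoc L v)} : Set (GtLoc L v))).subgroupOf N') = 2 := by
  rw [← Subgroup.index_eq_card]
  exact index_centralizer_subgroupOf_epsNormalizer_eq_two_of_typeTwo L Φ v hns γ₀ P e A u hP hA N' hN'

end TypeTwo

end Summit.HodgeConjecture.HodgeConjecture.R90.S4
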